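import Mathlib
import HarnessLib
import Literature.Computability.AlgebraicComplexity.VSBRProductDepth
import Literature.Computability.AlgebraicComplexity.BooleanPartVPFinite
import Summits.ValiantsHypothesis.ValiantsHypothesis.Theorems.MonotoneRestorationOrbitRestorationQPDepthThreeRungDefs

/-!
# Route MonotoneRestoration — crux `OrbitRestorationQP` (stmt-ValiantsHypothesis-18293), line
# `depth-three-rung`: stub `stub_vsbr` LANDED — `VP` slices have polynomial-size circuits of
# product-depth `O(log n)` (Valiant–Skyum–Berkowitz–Rackoff 1983)

Registered stub `stub_vsbr` of `Cruxes/OrbitRestorationQP/Lines/depth_three_rung.lean` (fwd-ladder G4),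
BY NAME AND SIGNATURE, over the line's vocabulary `VPClass` / `PDClass`
(`…OrbitRestorationQPDepthThreeRungDefs.lean`, verbatim the skeleton's): a family `f n` on the `n × n`
variable matrix with `deg (f n), L(f n) ≤ n^c + c` lies, for the constants `c₀ = 2c + 1` and
`c' = c + 2T + 3^T` (`T = 13c + 40`), in the product-depth slice
`PDClass (fun n => c₀ (log₂ n + 1)) n c'`: some unbounded-fan-in circuit computes `f n` with
product-depth `≤ c₀ (log₂ n + 1)` and at most `n^{c'} + c'` wires.

Proof: the general theorem `Literature/…/VSBRProductDepth.lean`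
(`DepthReduction.exists_computes_productDepth_le_clog`, VSBR in the product-depth model over any
commutative semiring: product-depth `≤ ⌈log₂ d⌉`, wires `≤ 9 (4 L (d+1)² + 1)⁴ (N+1) (d+1)`), then
p-bounded bookkeeping: `⌈log₂ (n^c + c)⌉ ≤ c ⌊log₂ n⌋ + 2c + 1 ≤ (2c+1)(⌊log₂ n⌋ + 1)`
(`clog_two_le_of_le_pow_add`) and `9 (4 s (d+1)² + 1)⁴ (n² + 1)(d + 1) ≤ (n+2)^T ≤ n^{2T} + 3^T`.

With this stub the skeleton's `OrbitRestorationQP_of_ladder` rests on `stub_logDepthRestoration` (the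
ladder's LIMIT, crux-strength) alone; the rung `SigmaPiSigmaRestorationQP` rests on stub A.  VP ≠ VNP is
not moved by this file (a 1983 theorem typed on the slices).

## References
* L. G. Valiant, S. Skyum, S. Berkowitz, C. Rackoff, *Fast parallel computation of polynomials using
  few processors*, SIAM J. Comput. 12 (1983) 641–644. [ValiantSkyumBerkowitzRackoff1983]
* P. Bürgisser, *Cook's versus Valiant's hypothesis*, TCS 235 (2000), Thm. 2.5. [Burgisser2000TCS]
* N. Limaye, S. Srinivasan, S. Tavenas, FOCS 2021, §1 (product depth). [LimayeSrinivasanTavenas2021]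
-/

noncomputable section

set_option linter.dupNamespace false

namespace Summit.ValiantsHypothesis.ValiantsHypothesis.Theorems.OrbitRestorationQPDepthThreeRung

open Literature.Computability.AlgebraicComplexity
open Literature.Computability.AlgebraicComplexity.DepthReduction

/-- Monotonicity of the p-bound `n^c + c` in `c` (with the `0^0 = 1` corner). [folklore] -/
theorem vsbr_pbound_mono {c c' : ℕ} (h : c ≤ c') (n : ℕ) : n ^ c + c ≤ n ^ c' + c' := by
  rcases Nat.eq_zero_or_pos n with rfl | hn
  · rcases Nat.eq_zero_or_pos c with rfl | hc
    · rcases Nat.eq_zero_or_pos c' with rfl | hc'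
      · simp
      · simp [Nat.zero_pow hc']; omega
    · have hc' : 0 < c' := lt_of_lt_of_le hc h
      simp [Nat.zero_pow hc, Nat.zero_pow hc']; exact h
  · exact Nat.add_le_add (Nat.pow_le_pow_right hn h) h

/-- `(n + 2)^T ≤ n^(2T) + 3^T` (`n ≥ 2`: `n + 2 ≤ n²`; `n ≤ 1`: `n + 2 ≤ 3`). [folklore] -/
theorem vsbr_pow_base_le (n T : ℕ) : (n + 2) ^ T ≤ n ^ (2 * T) + 3 ^ T := by
  rcases Nat.lt_or_ge n 2 with hn | hn
  · calc (n + 2) ^ T ≤ 3 ^ T := Nat.pow_le_pow_left (by omega) T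
      _ ≤ n ^ (2 * T) + 3 ^ T := Nat.le_add_left _ _
  · calc (n + 2) ^ T ≤ (n * n) ^ T := Nat.pow_le_pow_left (by nlinarith) T
      _ = n ^ (2 * T) := by rw [← pow_two, ← pow_mul]
      _ ≤ n ^ (2 * T) + 3 ^ T := Nat.le_add_right _ _

/-- p-bounded bookkeeping of the VSBR wire bound: for `s, d ≤ n^c + c`,
`9 (4 s (d+1)² + 1)⁴ (n² + 1) (d + 1) ≤ (n + 2)^(13c + 40)`. [folklore] -/
theorem vsbr_edgeBound_le_pow (n c : ℕ) {s d : ℕ} (hs : s ≤ n ^ c + c) (hd : d ≤ n ^ c + c) :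
    vsbrEdgeBound (n * n) d s ≤ (n + 2) ^ (13 * c + 40) := by
  set B := n + 2 with hB
  have hB2 : 2 ≤ B := by omega
  have hBpos : ∀ e, 1 ≤ B ^ e := fun e => Nat.one_le_pow _ _ (by omega)
  have hp : n ^ c + c ≤ 2 * B ^ c := le_two_mul_pow (le_refl _) (le_refl c)
  have hs' : s ≤ B ^ (c + 1) := by
    calc s ≤ 2 * B ^ c := hs.trans hp
      _ ≤ B * B ^ c := Nat.mul_le_mul_right _ hB2
      _ = B ^ (c + 1) := by ring
  have hd' : d + 1 ≤ B ^ (c + 2) := by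
    calc d + 1 ≤ 2 * B ^ c + B ^ c := Nat.add_le_add (hd.trans hp) (hBpos c)
      _ = 3 * B ^ c := by ring
      _ ≤ (B * B) * B ^ c := Nat.mul_le_mul_right _ (by nlinarith)
      _ = B ^ (c + 2) := by ring
  have hI : 4 * s * (d + 1) ^ 2 + 1 ≤ B ^ (3 * c + 8) := by
    calc 4 * s * (d + 1) ^ 2 + 1 ≤ 4 * B ^ (c + 1) * (B ^ (c + 2)) ^ 2 + B ^ (3 * c + 5) :=
          Nat.add_le_add (Nat.mul_le_mul (Nat.mul_le_mul_left _ hs') (Nat.pow_le_pow_left hd' 2))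
            (hBpos _)
      _ = 5 * B ^ (3 * c + 5) := by ring
      _ ≤ (B * B * B) * B ^ (3 * c + 5) := Nat.mul_le_mul_right _ (by nlinarith)
      _ = B ^ (3 * c + 8) := by ring
  have hN : n * n + 1 ≤ B ^ 2 := by rw [hB]; nlinarith
  have h9 : 9 ≤ B ^ 2 * B ^ 2 :=
    (by norm_num : 9 ≤ 2 ^ 2 * 2 ^ 2).trans
      (Nat.mul_le_mul (Nat.pow_le_pow_left hB2 2) (Nat.pow_le_pow_left hB2 2))
  unfold vsbrEdgeBound
  calc 9 * (4 * s * (d + 1) ^ 2 + 1) ^ 4 * (n * n + 1) * (d + 1)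
      ≤ (B ^ 2 * B ^ 2) * (B ^ (3 * c + 8)) ^ 4 * B ^ 2 * B ^ (c + 2) :=
        Nat.mul_le_mul (Nat.mul_le_mul (Nat.mul_le_mul h9 (Nat.pow_le_pow_left hI 4))
          hN) hd'
    _ = B ^ (13 * c + 40) := by ring

/-- **Stub `stub_vsbr` of line `depth-three-rung`, by name and signature — VSBR on the slices.**
A family on the `n × n` variable matrix with total degree and fan-in-two complexity `≤ n^c + c`
has, for `c₀ = 2c + 1` and some `c'`, unbounded-fan-in circuits of product-depth
`≤ c₀ (log₂ n + 1)` with `≤ n^{c'} + c'` wires (Valiant–Skyum–Berkowitz–Rackoff 1983, in the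
product-depth model; Bürgisser 2000 TCS, Thm. 2.5).
[cite: ValiantSkyumBerkowitzRackoff1983] [cite: Burgisser2000TCS, Thm. 2.5 p. 77] [cite: LimayeSrinivasanTavenas2021, §1] -/
theorem stub_vsbr :
    ∀ f : (n : ℕ) → MvPolynomial (Fin n × Fin n) ℂ, (∃ c : ℕ, ∀ n : ℕ, VPClass n c (f n)) →
      ∃ c₀ c' : ℕ, ∀ n : ℕ, PDClass (fun n => c₀ * (Nat.log 2 n + 1)) n c' (f n) := by
  rintro f ⟨c, hc⟩
  refine ⟨2 * c + 1, c + (2 * (13 * c + 40) + 3 ^ (13 * c + 40)), fun n => ?_⟩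
  obtain ⟨hdeg, hcx⟩ := hc n
  refine ⟨hdeg.trans (vsbr_pbound_mono (Nat.le_add_right _ _) n),
    hcx.trans (vsbr_pbound_mono (Nat.le_add_right _ _) n), ?_⟩
  obtain ⟨C, hCf, hCd, hCe⟩ := exists_computes_productDepth_le_clog (f n) hdeg
  refine ⟨C, hCf, hCd.trans ?_, hCe.trans ?_⟩
  · have h1 := clog_two_le_of_le_pow_add (le_refl (n ^ c + c))
    have h2 : c * Nat.log 2 n + 2 * c + 1 ≤ (2 * c + 1) * (Nat.log 2 n + 1) := by
      nlinarith [Nat.zero_le (c * Nat.log 2 n), Nat.zero_le (Nat.log 2 n)]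
    exact h1.trans h2
  · rw [Fintype.card_prod, Fintype.card_fin]
    refine (vsbr_edgeBound_le_pow n c hcx (le_refl _)).trans ?_
    refine (vsbr_pow_base_le n _).trans ?_
    set T := 13 * c + 40 with hT
    generalize 3 ^ T = P
    have hpow : n ^ (2 * T) ≤ n ^ (c + (2 * T + P)) := by
      rcases Nat.eq_zero_or_pos n with rfl | hn
      · rw [zero_pow (by omega)]; exact Nat.zero_le _
      · exact Nat.pow_le_pow_right hn (by omega)
    omega

end Summit.ValiantsHypothesis.ValiantsHypothesis.Theorems.OrbitRestorationQPDepthThreeRung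

end
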